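import Summits.QuantumFields.YangMills.Theorems.CurvatureKernelBound.Negative.Pinning
import Literature.Analysis.UnboundedOperators.HeatKernel
import Literature.MathematicalPhysics.QuantumFieldTheory.OSAxiomsFreeFieldKernelProofs

/-!
# `CurvatureKernelBound` — negative lemmas IV: free-field UV calibration in `d = 4`

Supports crux item `stmt-QuantumFields-11687` (`PencilRigidity.CurvatureKernelBound`: for every compact simple
`G`, `r`, `sch` and one-species `S₁` carrying the curvature package `W₁`, the two-point function of `S₁` on `⁰𝒮`
is integration against a REAL kernel `K(x₀ − x₁)`, continuous off `0`, with `|K x| ≤ C (1 + ‖x‖^(η−10))`,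
`η > 0`). Standing disprover's negative lemmas (refuter, cdisprove); no conclusion below asserts a Theses
statement positively.

§F. For the tree's free propagator kernel `G_m(x) = ∫₀^∞ e^{-m²t} heatKernel t x dt` in `d = 4`:
`e^{-m‖x‖}/(4π²‖x‖²) ≤ G_m(x) ≤ 1/(4π²‖x‖²)` off `0` (`FreeKernel.G_ge`, `FreeKernel.G_le`, from the
subordination integral by the explicit primitive `Φ r t = e^{-r²/4t}/(4π²r²)` of `φ r t = (4πt)⁻² e^{-r²/4t}`),
and the UV calibration `|s² G_m(s w) − (4π²‖w‖²)⁻¹| ≤ m s/(4π²‖w‖)` (`FreeKernel.abs_sq_mul_G_smul_sub_le`): the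
analytic input of the order-insufficiency witnesses of parts V–VII (dressed free two-point functions, whose
`⁰𝒮`-dilations scale like the FORBIDDEN rate `s⁻²`). [folklore]
-/

open scoped BigOperators Topology SchwartzMap
open MeasureTheory Filter Set
open Literature.MathematicalPhysics.QuantumLattice Literature.MathematicalPhysics.AQFT
  Literature.MathematicalPhysics.QuantumFieldTheory

noncomputable section

namespace Summit.QuantumFields.YangMills.Theorems.CurvatureKernelBound.Negative

/-! ## §F Free-field UV calibration in `d = 4` (support for §D and for provers' Gaussian checks):
`e^{-m‖x‖}/(4π²‖x‖²) ≤ G_m(x) ≤ 1/(4π²‖x‖²)` for the tree's free propagator kernel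
`G_m(x) = ∫₀^∞ e^{-m²t} p_t(x) dt`, hence `s² G_m(s w) → (4π²‖w‖²)⁻¹` uniformly on annuli. -/

namespace FreeKernel

open Real Literature.Analysis.UnboundedOperators

/-- `dim ℝ⁴ = 4`. [folklore] -/
theorem finrank_E4 : Module.finrank ℝ E4 = 4 := by simp

/-- The subordination integrand in `d = 4`: `φ_r(t) = (4πt)⁻² e^{-r²/(4t)}`. -/
def φ (r t : ℝ) : ℝ := ((4 * π * t) ^ 2)⁻¹ * Real.exp (-r ^ 2 / (4 * t))

/-- Its primitive `Φ_r(t) = e^{-r²/(4t)}/(4π²r²)` for `t > 0`, extended by `0`. -/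
def Φ (r t : ℝ) : ℝ := if t ≤ 0 then 0 else Real.exp (-r ^ 2 / (4 * t)) / (4 * π ^ 2 * r ^ 2)

/-- The primitive `Φ r` at positive times. [folklore] -/
theorem Φ_of_pos (r : ℝ) {t : ℝ} (ht : 0 < t) :
    Φ r t = Real.exp (-r ^ 2 / (4 * t)) / (4 * π ^ 2 * r ^ 2) := by
  simp [Φ, not_le.2 ht]

/-- `Φ r 0 = 0`. [folklore] -/
theorem Φ_zero (r : ℝ) : Φ r 0 = 0 := by simp [Φ]

/-- The heat kernel on `ℝ⁴`: `p_t(x) = (4πt)⁻² e^{-‖x‖²/(4t)}`. -/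
theorem heatKernel_E4 {t : ℝ} (ht : 0 < t) (x : E4) : heatKernel t x = φ ‖x‖ t := by
  unfold heatKernel φ
  rw [finrank_E4]
  congr 1
  have h4 : (0 : ℝ) ≤ 4 * π * t := by positivity
  rw [show (-((4 : ℕ) : ℝ) / 2) = -(2 : ℝ) by norm_num, Real.rpow_neg h4, Real.rpow_two]

/-- The heat profile `φ` is non-negative. [folklore] -/
theorem φ_nonneg (r t : ℝ) : 0 ≤ φ r t := by unfold φ; positivity

/-- `Φ r` is a primitive of `φ r` on `(0, ∞)` (for `r ≠ 0`). [folklore] -/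
theorem hasDerivAt_Φ {r t : ℝ} (hr : r ≠ 0) (ht : 0 < t) : HasDerivAt (Φ r) (φ r t) t := by
  have hΦ : (Φ r) =ᶠ[𝓝 t] fun s => Real.exp (-r ^ 2 / (4 * s)) / (4 * π ^ 2 * r ^ 2) := by
    filter_upwards [Ioi_mem_nhds ht] with s hs
    exact Φ_of_pos r hs
  refine HasDerivAt.congr_of_eventuallyEq ?_ hΦ
  -- derivative of the explicit formula
  have h1 : HasDerivAt (fun s : ℝ => -r ^ 2 / (4 * s)) (r ^ 2 / (4 * t ^ 2)) t := by
    have h := ((hasDerivAt_inv ht.ne').const_mul (-r ^ 2 / 4))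
    have heq : (fun s : ℝ => -r ^ 2 / (4 * s)) = fun y => -r ^ 2 / 4 * y⁻¹ := by
      funext s; ring
    rw [heq]
    refine h.congr_deriv ?_
    field_simp
  have h2 := (h1.exp).div_const (4 * π ^ 2 * r ^ 2)
  refine h2.congr_deriv ?_
  unfold φ
  field_simp

/-- `e^{-r²/4t} / (4π² r²) → 0` as `t → 0⁺` (for `r ≠ 0`). [folklore] -/
theorem tendsto_exp_neg_div_nhdsGT (r : ℝ) (hr : r ≠ 0) :
    Tendsto (fun t : ℝ => Real.exp (-r ^ 2 / (4 * t))) (𝓝[>] 0) (𝓝 0) := by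
  have hc : 0 < r ^ 2 / 4 := by positivity
  have h1 : Tendsto (fun t : ℝ => r ^ 2 / 4 * t⁻¹) (𝓝[>] 0) atTop :=
    tendsto_inv_nhdsGT_zero.const_mul_atTop hc
  have h2 : Tendsto (fun t : ℝ => -(r ^ 2 / 4 * t⁻¹)) (𝓝[>] 0) atBot :=
    tendsto_neg_atTop_atBot.comp h1
  have h3 := Real.tendsto_exp_atBot.comp h2
  refine h3.congr' ?_
  filter_upwards [self_mem_nhdsWithin] with t ht
  simp only [Function.comp_apply]
  congr 1
  rw [mem_Ioi] at ht
  field_simp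

/-- `Φ r` is right-continuous at `0`. [folklore] -/
theorem continuousWithinAt_Φ_zero (r : ℝ) (hr : r ≠ 0) : ContinuousWithinAt (Φ r) (Ici 0) 0 := by
  rw [← Ioi_insert, continuousWithinAt_insert_self]
  show Tendsto (Φ r) (𝓝[>] 0) (𝓝 (Φ r 0))
  rw [Φ_zero]
  have h := (tendsto_exp_neg_div_nhdsGT r hr).div_const (4 * π ^ 2 * r ^ 2)
  rw [zero_div] at h
  refine h.congr' ?_
  filter_upwards [self_mem_nhdsWithin] with t ht
  exact (Φ_of_pos r ht).symm

/-- `Φ r` is continuous within `[0, ∞)` at every `a ≥ 0`. [folklore] -/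
theorem continuousWithinAt_Φ {r a : ℝ} (hr : r ≠ 0) (ha : 0 ≤ a) :
    ContinuousWithinAt (Φ r) (Ici a) a := by
  rcases ha.eq_or_lt with rfl | ha'
  · exact continuousWithinAt_Φ_zero r hr
  · exact (hasDerivAt_Φ hr ha').continuousAt.continuousWithinAt

/-- `Φ r t → (4π² r²)⁻¹` as `t → ∞`. [folklore] -/
theorem tendsto_Φ_atTop (r : ℝ) (hr : r ≠ 0) :
    Tendsto (Φ r) atTop (𝓝 (1 / (4 * π ^ 2 * r ^ 2))) := by
  have h1 : Tendsto (fun t : ℝ => -r ^ 2 / 4 * t⁻¹) atTop (𝓝 (-r ^ 2 / 4 * 0)) :=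
    tendsto_inv_atTop_zero.const_mul _
  rw [mul_zero] at h1
  have h2 : Tendsto (fun t : ℝ => Real.exp (-r ^ 2 / 4 * t⁻¹)) atTop (𝓝 1) := by
    simpa [Function.comp_def] using (Real.continuous_exp.tendsto 0).comp h1
  have h3 := h2.div_const (4 * π ^ 2 * r ^ 2)
  refine h3.congr' ?_
  filter_upwards [eventually_gt_atTop 0] with t ht
  rw [Φ_of_pos r ht]
  congr 2
  field_simp

/-- `∫_a^∞ φ_r = 1/(4π²r²) − Φ_r(a)` for `a ≥ 0`, and `φ_r` is integrable there. -/
theorem integral_φ_Ioi {r a : ℝ} (hr : r ≠ 0) (ha : 0 ≤ a) :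
    ∫ t in Ioi a, φ r t = 1 / (4 * π ^ 2 * r ^ 2) - Φ r a :=
  integral_Ioi_of_hasDerivAt_of_nonneg (continuousWithinAt_Φ hr ha)
    (fun _ ht => hasDerivAt_Φ hr (ha.trans_lt ht)) (fun t _ => φ_nonneg r t) (tendsto_Φ_atTop r hr)

/-- `φ r` is integrable on `(a, ∞)`, `a ≥ 0`, `r ≠ 0`. [folklore] -/
theorem integrableOn_φ_Ioi {r a : ℝ} (hr : r ≠ 0) (ha : 0 ≤ a) :
    IntegrableOn (φ r) (Ioi a) :=
  integrableOn_Ioi_deriv_of_nonneg (continuousWithinAt_Φ hr ha)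
    (fun _ ht => hasDerivAt_Φ hr (ha.trans_lt ht)) (fun t _ => φ_nonneg r t) (tendsto_Φ_atTop r hr)

/-- `∫₀^T φ_r = Φ_r(T)`. -/
theorem integral_φ_Ioc {r T : ℝ} (hr : r ≠ 0) (hT : 0 < T) :
    ∫ t in Ioc 0 T, φ r t = Φ r T := by
  have hu : Ioc 0 T ∪ Ioi T = Ioi 0 := Ioc_union_Ioi_eq_Ioi hT.le
  have hdisj : Disjoint (Ioc 0 T) (Ioi T) := fun s h1 h2 x hx => by
    have a := h1 hx; have b := h2 hx
    exact absurd (mem_Ioc.1 a).2 (not_le.2 (mem_Ioi.1 b))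
  have hint := integrableOn_φ_Ioi hr le_rfl (a := 0)
  have h := setIntegral_union hdisj measurableSet_Ioi (hint.mono_set (by rw [← hu]; exact subset_union_left))
    (hint.mono_set (by rw [← hu]; exact subset_union_right))
  rw [hu, integral_φ_Ioi hr le_rfl, integral_φ_Ioi hr hT.le, Φ_zero] at h
  linarith

/-- The free propagator kernel of mass `m` on `ℝ⁴` (tree convention, written out). -/
def G (m : ℝ) (x : E4) : ℝ := ∫ t in Ioi (0 : ℝ), Real.exp (-m ^ 2 * t) * heatKernel t x

/-- The free kernel as the subordination integral of the radial heat profile. [folklore] -/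
theorem G_eq (m : ℝ) (x : E4) : G m x = ∫ t in Ioi (0 : ℝ), Real.exp (-m ^ 2 * t) * φ ‖x‖ t :=
  setIntegral_congr_fun measurableSet_Ioi fun t ht => by rw [heatKernel_E4 (mem_Ioi.1 ht)]

/-- **Upper bound** `G_m(x) ≤ 1/(4π²‖x‖²)` (`x ≠ 0`). -/
theorem G_le {m : ℝ} {x : E4} (hx : x ≠ 0) : G m x ≤ 1 / (4 * π ^ 2 * ‖x‖ ^ 2) := by
  have hr : ‖x‖ ≠ 0 := norm_ne_zero_iff.2 hx
  have h : ∫ t in Ioi 0, φ ‖x‖ t = 1 / (4 * π ^ 2 * ‖x‖ ^ 2) := by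
    rw [integral_φ_Ioi hr le_rfl, Φ_zero, sub_zero]
  rw [G_eq, ← h]
  refine setIntegral_mono_on ?_ (integrableOn_φ_Ioi hr le_rfl) measurableSet_Ioi fun t ht => ?_
  · refine (integrableOn_φ_Ioi hr le_rfl).mono' ?_ ?_
    · exact ((Real.continuous_exp.comp (continuous_const.mul continuous_id)).aestronglyMeasurable).mul
        (integrableOn_φ_Ioi hr le_rfl).aestronglyMeasurable
    · refine (ae_restrict_iff' measurableSet_Ioi).2 (ae_of_all _ fun t ht => ?_)
      rw [Real.norm_eq_abs, abs_mul, abs_of_nonneg (Real.exp_pos _).le, abs_of_nonneg (φ_nonneg _ _)]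
      refine mul_le_of_le_one_left (φ_nonneg _ _) ?_
      rw [Real.exp_le_one_iff]
      nlinarith [mem_Ioi.1 ht, sq_nonneg m]
  · refine mul_le_of_le_one_left (φ_nonneg _ _) ?_
    rw [Real.exp_le_one_iff]
    nlinarith [mem_Ioi.1 ht, sq_nonneg m]

/-- **Lower bound** `e^{-m‖x‖}/(4π²‖x‖²) ≤ G_m(x)` (`0 < m`, `x ≠ 0`). -/
theorem G_ge {m : ℝ} (hm : 0 < m) {x : E4} (hx : x ≠ 0) :
    Real.exp (-(m * ‖x‖)) / (4 * π ^ 2 * ‖x‖ ^ 2) ≤ G m x := by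
  set r := ‖x‖ with hrdef
  have hr0 : 0 < r := norm_pos_iff.2 hx
  have hr : r ≠ 0 := hr0.ne'
  set T := r / (2 * m) with hT
  have hT0 : 0 < T := by positivity
  -- restrict to (0, T]
  have hint : IntegrableOn (fun t => Real.exp (-m ^ 2 * t) * φ r t) (Ioi 0) := by
    refine (integrableOn_φ_Ioi hr le_rfl).mono' ?_ ?_
    · exact ((Real.continuous_exp.comp (continuous_const.mul continuous_id)).aestronglyMeasurable).mul
        (integrableOn_φ_Ioi hr le_rfl).aestronglyMeasurable
    · refine (ae_restrict_iff' measurableSet_Ioi).2 (ae_of_all _ fun t ht => ?_)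
      rw [Real.norm_eq_abs, abs_mul, abs_of_nonneg (Real.exp_pos _).le, abs_of_nonneg (φ_nonneg _ _)]
      refine mul_le_of_le_one_left (φ_nonneg _ _) ?_
      rw [Real.exp_le_one_iff]
      nlinarith [mem_Ioi.1 ht, sq_nonneg m]
  have step1 : ∫ t in Ioc 0 T, Real.exp (-m ^ 2 * t) * φ r t ≤ G m x := by
    rw [G_eq]
    exact setIntegral_mono_set hint
      (Eventually.of_forall fun t => mul_nonneg (Real.exp_pos _).le (φ_nonneg _ _))
      Ioc_subset_Ioi_self.eventuallyLE
  have step2 : Real.exp (-m ^ 2 * T) * Φ r T ≤ ∫ t in Ioc 0 T, Real.exp (-m ^ 2 * t) * φ r t := by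
    rw [← integral_φ_Ioc hr hT0, ← integral_const_mul]  -- ∫ e^{-m²T} φ
    refine setIntegral_mono_on ?_ (hint.mono_set Ioc_subset_Ioi_self) measurableSet_Ioc fun t ht => ?_
    · exact ((integrableOn_φ_Ioi hr le_rfl).mono_set Ioc_subset_Ioi_self).const_mul _
    · refine mul_le_mul_of_nonneg_right ?_ (φ_nonneg _ _)
      exact Real.exp_le_exp.2 (by nlinarith [(mem_Ioc.1 ht).2, sq_nonneg m])
  have step3 : Real.exp (-m ^ 2 * T) * Φ r T = Real.exp (-(m * r)) / (4 * π ^ 2 * r ^ 2) := by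
    rw [Φ_of_pos r hT0, mul_div_assoc', ← Real.exp_add]
    congr 2
    rw [hT]; field_simp; ring
  linarith [step1, step2, step3.symm.le, step3.le]


/-- **Uniform free-field asymptotics on annuli**: `|s² G_m(s w) − 1/(4π²‖w‖²)| ≤ m s/(4π²‖w‖)`
(`0 < m`, `w ≠ 0`, `0 < s`): `s² G_m(s·)` converges to the massless kernel `(4π²‖w‖²)⁻¹`
uniformly on `{‖w‖ ≥ δ}` at rate `O(s)`. -/
theorem abs_sq_mul_G_smul_sub_le {m : ℝ} (hm : 0 < m) {w : E4} (hw : w ≠ 0) {s : ℝ} (hs : 0 < s) :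
    |s ^ 2 * G m (s • w) - 1 / (4 * π ^ 2 * ‖w‖ ^ 2)| ≤ m * s / (4 * π ^ 2 * ‖w‖) := by
  have hsw : s • w ≠ 0 := smul_ne_zero hs.ne' hw
  have h1 := G_le (m := m) hsw
  have h2 := G_ge hm hsw
  rw [norm_smul, Real.norm_of_nonneg hs.le] at h1 h2
  have hr : 0 < ‖w‖ := norm_pos_iff.2 hw
  have key_up : s ^ 2 * G m (s • w) ≤ 1 / (4 * π ^ 2 * ‖w‖ ^ 2) := by
    calc s ^ 2 * G m (s • w) ≤ s ^ 2 * (1 / (4 * π ^ 2 * (s * ‖w‖) ^ 2)) := by gcongr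
      _ = 1 / (4 * π ^ 2 * ‖w‖ ^ 2) := by field_simp
  have key_lo : Real.exp (-(m * (s * ‖w‖))) / (4 * π ^ 2 * ‖w‖ ^ 2) ≤ s ^ 2 * G m (s • w) := by
    calc Real.exp (-(m * (s * ‖w‖))) / (4 * π ^ 2 * ‖w‖ ^ 2)
        = s ^ 2 * (Real.exp (-(m * (s * ‖w‖))) / (4 * π ^ 2 * (s * ‖w‖) ^ 2)) := by
          field_simp
      _ ≤ s ^ 2 * G m (s • w) := by gcongr
  have hexp : 1 - Real.exp (-(m * (s * ‖w‖))) ≤ m * (s * ‖w‖) := by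
    have := Real.add_one_le_exp (-(m * (s * ‖w‖)))
    linarith
  rw [abs_sub_le_iff]
  constructor
  · have : 0 ≤ m * s / (4 * π ^ 2 * ‖w‖) := by positivity
    linarith
  · calc 1 / (4 * π ^ 2 * ‖w‖ ^ 2) - s ^ 2 * G m (s • w)
        ≤ 1 / (4 * π ^ 2 * ‖w‖ ^ 2) - Real.exp (-(m * (s * ‖w‖))) / (4 * π ^ 2 * ‖w‖ ^ 2) := by
          linarith
      _ = (1 - Real.exp (-(m * (s * ‖w‖)))) / (4 * π ^ 2 * ‖w‖ ^ 2) := by ring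
      _ ≤ m * (s * ‖w‖) / (4 * π ^ 2 * ‖w‖ ^ 2) := by gcongr
      _ = m * s / (4 * π ^ 2 * ‖w‖) := by field_simp


end FreeKernel

end Summit.QuantumFields.YangMills.Theorems.CurvatureKernelBound.Negative
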